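/-
Origin: expansion seat `planner-pub-hodgecm-prl2-g9-0`, handover #2 2026-08-18T17:04Z md5 8dbbe91ceb69320000dfb4445ff3c766 (NEW additive leaf, 353 l.; imports Mathlib, the tree module HodgeCM.StubTree.EndStateByName (prl2-g8 RUN-31 row 5 AS INSTALLED — no rewrite) and Prl2g9.GlobalToLocalByName -> ONE REWRITE to HodgeCM.Literature.GlobalToLocalByName (this seat #1; land AFTER #1); decls: HodgeCM.Universe.BMMDict.LineLiftDatum (structure) + .LineDef/.SigConv/.Li (`HOME/pub-hodgecm-prl2-g9/lean/Prl2g9/LineLiftByName.lean`, md5 8dbbe91c, 352 lines);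
landed by the packager successor (mc-unitary-1-g3, gen-8 kit) in gate run 32 as `HodgeCM/StubTree/LineLiftByName.lean` (import ^import Prl2g9\.GlobalToLocalByName[ \t]*$→import HodgeCM.Literature.GlobalToLocalByName ×1).
-/
/-
WIP — pub-hodgecm EXPANSION prover a-2 "REDUCE, don't construct", generation 9 (unit pub-hodgecm-prl2-g9).
Target in the package: `HodgeCM/StubTree/LineLiftByName.lean` (ONE import rewrite: `import Prl2g9.GlobalToLocalByName` →
`import HodgeCM.Literature.GlobalToLocalByName`, this seat's companion file; `HodgeCM.StubTree.EndStateByName` is the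
tree module installed by RUN 31, row 5 of prl2-g8).
-/
import Mathlib
import Summits.HodgeConjecture.HodgeCM.StubTree.EndStateByName
import Summits.HodgeConjecture.HodgeCM.Literature.GlobalToLocalByName

/-!
# The two archimedean readings of generation 8 RE-BASED on one line-lift datum: the `v₁` reading DERIVED from a
# design line-definition, a signature convention and the global-to-local step of [BMM16]'s printed proof of Thm 7.2;
# the compact-place reading re-stated on the character datum with the weight predicate DEFINED (generation 9)

CHARGE (REDUCTION-v8 §R.42 (a″), GAPS prl2g8-O3).  Generation 8 reduced `RealisationExistsPerL/Face` to the package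
`BMMPrintPerL/Face T` whose ONLY non-print, non-kernel conjuncts about the archimedean places were two READINGS:
`ArchLineDatum.Reading` (at `v₁`: the automorphic representation generated by a non-zero class of `lineTheta Γ a Φ` has
`π_{v₁} = A(b×q,a×q)` IN THE IMAGE of the local theta correspondence from `U(W, ℂ/ℝ)` of signature `sigAt ι₁ a`) and
`CompactLineDatum.CompactTheta ∧ TypeWeight` (at a compact place: the block's genuine `τ`-weight corresponds to Adams'
vacuum type in the dictionary chosen by the sign of `a`, and the `L`-type records the signs of the weights).

WHAT THIS FILE DOES.
(A) — in the companion file `HodgeCM.Literature.GlobalToLocalByName` (package twin of the hub-tree module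
`Literature/RepresentationTheory/BergeronMillsonMoeglin2016/GlobalToLocalStep.lean`, prl2-g9): over the cited-fact
seat's `BMMArchSpectrum` — `Prop134` ([BMM16] Prop. 13.4 verbatim), `GlobalToLocal` (the INFERENCE the printed proof
of [BMM16] Thm 7.2, Acta pp. 65–66, uses between Prop. 13.4 and A. Paul's signature sentence: a global `ψ`-theta lift
from `U(W)` has `π_∞` in the image of the LOCAL theta correspondence from `U(W ⊗ ℝ) = U(W, ℂ/ℝ)`, a group of
signature `sig_∞(W)` — LABEL: a step of a printed proof), and **`GlobalToLocalStable` — the same inference in the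
STABLE RANGE `2·dim W < m`, where it IS a printed theorem: J.-S. Li's theorem AS PRINTED in Cossutta–Marshall,
IMRN 2013 (11) 2601–2623, §2** (tree bib `CossuttaMarshall2012`; held arXiv:1106.2765 chunk p0007 L61–65: for a cusp
form `π'` on `U(W)` with `n > 2n'` the theta lift `Θ(π', V)` "is an irreducible automorphic representation which is
isomorphic to `⊗_v θ(π'_v, V_v)`"; [Li2] = Li, Crelle 428 (1992), bib `Li1992`).  PerL's pair `(U(⟨a⟩), U(V))`,
`dim V = 3 > 2`, IS in the stable range.  KERNEL there: `thm78_of_prop134(_stable)` — the printed proof of Thm 7.2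
certified, at `m = 3` from PRINTED statements only.
(B) ONE DESIGN DATUM `LineLiftDatum BD` for both kinds of archimedean places: `W Γ a` = the skew-hermitianised line
`⟨a⟩` as a member of the dictionary's `SkewHerm` at level `Γ` ([BMM16] Remark after §7.1: "we will sometimes
abusively refer to `W` as a Hermitian space; note however that this involves the choice of `α`"), and `wt Γ a Φ τ` =
the genuine `τ`-weight of the automorphic character of `U(⟨a⟩)(𝔸)` whose global theta lift carries the non-zero
classes of `lineTheta Γ a Φ`.  Hypotheses on it, each labelled: `LineDef` (DESIGN — THE OBSTRUCTION: a non-zero class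
of `lineTheta Γ a Φ` generates `A(b×q,a×q) ⊗ π_f` IN THE IMAGE of the `ψ`-theta correspondence from `U(W Γ a)` —
this is the DEFINITION of the 2001 construction's line theta classes read in [BMM16]'s language, Def 7.5/§7.7; not in
print, not kernel); `SigConv` (CONVENTION: the `v₁`-signature of `W Γ a` is `sigAt ι₁ a` for every line carrying a
non-zero class — [BMM16]'s choice of `α`); `LineDim` (DEFINITION: such a `W Γ a` is one-dimensional, `dim_E ⟨a⟩ = 1`); `TypeDef CD` (DEFINITION: the block's `L`-type records the signs of the
genuine weights at the Fock-holomorphic embeddings off `v₁` — [Liu21] p. 18 `Φ_μ` + the splitting shift, GAPS ff2-X1);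
`LocalAway CD` (READING, compact places: the genuine weight `wt Γ a Φ τ` corresponds to the vacuum `K̃′`-type in
Adams' dictionary of the sign of `a` at `τ` = global-to-local compatibility at the compact place ∘ "cohomological with
trivial coefficients ⇒ trivial on the compact factor `U(3)` ⇒ `τ′_vac` in Adams' genuine normalisation").
(C) KERNEL: **`reading_of_globalToLocalStable : BD.Standard T → (∀ Γ, (AD.spectrum Γ).GlobalToLocalStable) →
LD.LineDef → LD.LineDim → LD.SigConv → AD.Reading`** — generation 8's `v₁` reading is DERIVED FROM PRINT (`m = 3` and
`dim W = 1` put the pair in Li's stable range); `reading_of_globalToLocal` (the same from the general proof-step); `compactTheta_of_localAway`, `typeWeight_of_typeDef` for the re-weighted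
compact datum `LD.reweight CD` (its `IsWt` is DEFINED from `wt`: one posited predicate fewer); the packages
`BMMLiftFace/PerL T`; `bmmPrintFace/PerL_of_lift : BMMLift… T → BMMPrint… T`; the end states
`COR_CM/perL44/perL_of_liu_bmmLift(_adelic)`.

BINDER CENSUS of `perL_of_liu_bmmLift_adelic` (generation 9; cf. REDUCTION-v8 §R.43): unchanged outside the package;
inside `BMMLiftPerL T`: PRINT BY NAME — `Cor79` ([BMM16] Cor 7.3; doc note cfR8-N1: its printed proof for the
non-quasi-split `G` of PerL rests on the endoscopic classification for inner forms of unitary groups, in print only for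
generic parameters (KMSW) as of 2026-08 — "unconditional at `m = 3` via Rogawski" is true but a READING, BMM do not
print the substitution), `ArchSignature` ([BMM16] p. 66 after [Paul98]), **`GlobalToLocalStable` (Li 1992 as printed in
Cossutta–Marshall 2013 §2)**, `CD.Print` (Adams 2007 Prop. 6.6); READINGS — `LineAlbaneseLiu` ([Liu21] §4.2),
`LocalAway` (compact places); DEFINITIONS/CONVENTIONS exposed — `SigConv`, `LineDim`, `TypeDef`; MODEL —
`UisoDisjoint`, `UisoRigid`, `Standard` (descent); DESIGN — `LineDef` (THE OBSTRUCTION), `ThetaOfLine`, `LineOfTheta`,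
`FrameBidegree`, `FrameOrientation`.  VERDICT (GAPS prl2g9-O4): of generation 8's two archimedean readings, the `v₁`
one is DISCHARGED into PRINT (Li/C–M) + convention + definition + THE design definition of the line class; the compact one is
re-based on the same datum (weight predicate defined) and remains a reading whose print content is the compact-place
instance of the same compatibility.  THE input not in print is now ONE design statement, `LineDef` — the definition of
the line class — as generation 8 predicted ("beyond that only the DEFINITION of the line class remains").
-/

set_option autoImplicit false

noncomputable section

open NumberField

namespace HodgeCM


open Literature.AlgebraicGeometry.Motives (CMType)
open HodgeCM.Literature.BMM (BMMSpectrum BMMArchSpectrum)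
open HodgeCM.Literature.UpUmnTheta (vacuumTau vacuumWt)

namespace Universe

variable {U : Universe}

namespace BMMDict

variable {L : CMField} {ι₁ : L →+* ℂ} {V : HermSpace3 L ι₁} (BD : U.BMMDict V)

/-! ## (B) The line-lift datum and its labelled hypotheses -/

/-- **DESIGN DATUM — the line lift**: for each level `Γ` and `a : L`, `W Γ a` = the line `⟨a⟩ = (L, a x ȳ)` skew-
hermitianised as one of [BMM16]'s spaces `W` (a member of the dictionary's `SkewHerm` at `Γ`; Remark after §7.1: the
choice of `α`); and `wt Γ a Φ τ : ℚ` = the genuine `τ`-weight of the automorphic character `η` of `U(⟨a⟩)(𝔸_{L₀})`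
whose global `ψ`-theta lift carries the non-zero classes of `BD.lineTheta Γ a Φ` (posited MODEL primitives; nothing is
asserted by the structure). -/
structure LineLiftDatum where
  /-- the skew-hermitianised line `⟨a⟩` at level `Γ` -/
  W : (Γ : Level V) → L → (BD.X Γ).SkewHerm
  /-- the genuine `τ`-weight of the character lifted to the `(Γ, a, Φ)`-block -/
  wt : Level V → L → CMType L → (L →+* ℂ) → ℚ

namespace LineLiftDatum

variable {BD} (LD : BD.LineLiftDatum)

/-- **DESIGN — THE OBSTRUCTION (labelled; the definition of the line class, never citable)**: a non-zero class of
`BD.lineTheta Γ a Φ` generates, at the fine level after realisation, the automorphic representation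
`A(b×q, a×q) ⊗ π_f` of the datum's bidegree (`BD.Standard.h10_le`) for some `π_f`, and that representation IS in the
image of the `ψ`-theta correspondence from `U(W Γ a)` in the sense of [BMM16] Def 7.5 / §7.7 (`IsThetaLiftFrom`).  This
is what "`lineTheta Γ a Φ` = theta lifts from the unitary group of the line `⟨a⟩`" MEANS for the 2001 construction;
it is the one input of the archimedean layer that is neither in print nor kernel. -/
def LineDef : Prop :=
  ∀ (Γ : Level V) (a : L) (Φ : CMType L) (θ : U.CohC (U.pms L ι₁ V Γ) 1), θ ∈ BD.lineTheta Γ a Φ → θ ≠ 0 →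
    ∃ πf : (BD.X Γ).RepF, (BD.X Γ).IsThetaLiftFrom ((BD.X Γ).A BD.b BD.a) πf (LD.W Γ a)

/-- **CONVENTION (exposed, never cited)**: for every line `⟨a⟩` carrying a non-zero theta class at level `Γ`, the
signature at `v₁` of the skew-hermitianised line `W Γ a` is `sigAt ι₁ a` — `(1,0)` if `ι₁(a) > 0`, else `(0,1)`
([BMM16]'s choice of `α` in the Remark after §7.1; the opposite choice swaps `sigAt` AND the seam `FrameBidegree`,
cf. generation 8's `ArchLineDatum.Reading` docstring). -/
def SigConv : Prop :=
  ∀ (Γ : Level V) (a : L),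
    (∃ (Φ : CMType L) (θ : U.CohC (U.pms L ι₁ V Γ) 1), θ ∈ BD.lineTheta Γ a Φ ∧ θ ≠ 0) →
      (BD.X Γ).sigInf (LD.W Γ a) = sigAt ι₁ a

/-- **DEFINITION (exposed, never cited)**: for every line `⟨a⟩` carrying a non-zero theta class at level `Γ`, the
skew-hermitianised line `W Γ a` is ONE-dimensional over `L` in the dictionary's spectrum (`dim_E W = 1`; [BMM16]
§7: "`W` a `n`-dimensional vector space over `E`" with `n = 1` for a line).  With `m = 3` (`BD.Standard.m_eq`) this
puts the pair `(U(W Γ a), U(V))` in Li's stable range `2·dim W < m`. -/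
def LineDim : Prop :=
  ∀ (Γ : Level V) (a : L),
    (∃ (Φ : CMType L) (θ : U.CohC (U.pms L ι₁ V Γ) 1), θ ∈ BD.lineTheta Γ a Φ ∧ θ ≠ 0) →
      (BD.X Γ).dimW (LD.W Γ a) = 1

/-- **KERNEL — generation 8's `v₁` reading DERIVED**: the global-to-local step of [BMM16]'s printed proof (by name on
every spectrum `AD.spectrum Γ`), the design line-definition and the signature convention give
`ArchLineDatum.Reading`: a non-zero class of `lineTheta Γ a Φ` yields `π_f` with `A(b×q,a×q) ⊗ π_f` a global lift from
`U(W Γ a)` (`LineDef`); the printed step makes `A(b×q,a×q)` a LOCAL lift at `v₁` from a group of signature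
`sig_{v₁}(W Γ a)` (`GlobalToLocal`), which is `sigAt ι₁ a` (`SigConv`). -/
theorem reading_of_globalToLocal (AD : BD.ArchLineDatum) (hG : ∀ Γ, (AD.spectrum Γ).GlobalToLocal)
    (hD : LD.LineDef) (hS : LD.SigConv) : AD.Reading := by
  intro Γ a Φ θ hθ hne
  obtain ⟨πf, hπ⟩ := hD Γ a Φ θ hθ hne
  have h : AD.IsLoc Γ ((BD.X Γ).A BD.b BD.a) ((BD.X Γ).sigInf (LD.W Γ a)) := hG Γ _ πf _ hπ
  rw [hS Γ a ⟨Φ, θ, hθ, hne⟩] at h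
  exact h

/-- **KERNEL — generation 8's `v₁` reading DERIVED FROM PRINT at `m = 3`**: Li's stable-range theorem as printed in
[Cossutta–Marshall 2013] (by name on every spectrum `AD.spectrum Γ`), the design line-definition, the line's
dimension and the signature convention give `ArchLineDatum.Reading` — `LineDef` yields `π_f` with `A(b×q,a×q) ⊗ π_f`
a global lift from `U(W Γ a)`; `dim (W Γ a) = 1` and `m = 3` put the pair in the stable range, so the printed
theorem makes `A(b×q,a×q)` a LOCAL lift at `v₁` from a group of signature `sig_{v₁}(W Γ a) = sigAt ι₁ a`. -/
theorem reading_of_globalToLocalStable {T : U.ThetaModel} (hBD : BD.Standard T) (AD : BD.ArchLineDatum)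
    (hG : ∀ Γ, (AD.spectrum Γ).GlobalToLocalStable) (hD : LD.LineDef) (h1 : LD.LineDim) (hS : LD.SigConv) :
    AD.Reading := by
  intro Γ a Φ θ hθ hne
  obtain ⟨πf, hπ⟩ := hD Γ a Φ θ hθ hne
  have hlt : 2 * (BD.X Γ).dimW (LD.W Γ a) < (BD.X Γ).m := by
    rw [h1 Γ a ⟨Φ, θ, hθ, hne⟩, hBD.m_eq Γ]
    norm_num
  have h : AD.IsLoc Γ ((BD.X Γ).A BD.b BD.a) ((BD.X Γ).sigInf (LD.W Γ a)) := hG Γ _ πf _ hlt hπ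
  rw [hS Γ a ⟨Φ, θ, hθ, hne⟩] at h
  exact h

/-- COROLLARY (kernel): with the print fact `ArchSignature` by name as well, every line carrying a non-zero class of
the holomorphic type has `v₁`-signature equal to the datum's bidegree (generation 8's `sigAt_eq_of_arch`, now from
print + print-proof-step + design + convention). -/
theorem sigAt_eq_of_lift {T : U.ThetaModel} (hBD : BD.Standard T) (AD : BD.ArchLineDatum)
    (hP : ∀ Γ, (AD.spectrum Γ).ArchSignature) (hG : ∀ Γ, (AD.spectrum Γ).GlobalToLocal) (hD : LD.LineDef)
    (hS : LD.SigConv) {Γ : Level V} {a : L} {Φ : CMType L} {θ : U.CohC (U.pms L ι₁ V Γ) 1}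
    (hθ : θ ∈ BD.lineTheta Γ a Φ) (hne : θ ≠ 0) : sigAt ι₁ a = (BD.a, BD.b) :=
  BD.sigAt_eq_of_arch hBD AD hP (LD.reading_of_globalToLocal AD hG hD hS) hθ hne

/-! ### The compact places: the weight predicate DEFINED from the datum -/

/-- The compact datum RE-WEIGHTED by the line-lift datum: same Adams dictionaries and orientation bits, and the weight
predicate DEFINED — `IsWt Γ Φ τ σ` iff `τ` is a Fock-holomorphic embedding off `v₁` and `σ = wt Γ a Φ τ` for some line
`⟨a⟩` carrying a non-zero class of `lineTheta Γ a Φ` (one posited predicate fewer than generation 8). -/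
def reweight (CD : BD.CompactLineDatum) : BD.CompactLineDatum where
  Dpos := CD.Dpos
  Dneg := CD.Dneg
  orient := CD.orient
  IsWt := fun Γ Φ τ σ => τ ≠ ι₁ ∧ τ ≠ ComplexEmbedding.conjugate ι₁ ∧ CD.orient τ = true ∧
    ∃ (a : L) (θ : U.CohC (U.pms L ι₁ V Γ) 1), θ ∈ BD.lineTheta Γ a Φ ∧ θ ≠ 0 ∧ σ = LD.wt Γ a Φ τ

/-- **DEFINITION (exposed, never cited) — the `L`-type of the block's character**: for a block `(Γ, a, Φ)` carrying a
non-zero class and a Fock-holomorphic embedding `τ` off `v₁`, `τ ∈ Φ ⟺ 0 < wt Γ a Φ τ` — the CM type `Φ_μ` of a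
conjugate-symplectic automorphic character is the set of embeddings at which its exponent has the prescribed sign
([Liu21] p. 18, before Def. 4.3), composed with the splitting-character shift between the genuine theta weight and `μ`
(GAPS ff2-X1); jointly conventional with `FrameOrientation` (generation 8's `TypeWeight` docstring). -/
def TypeDef (CD : BD.CompactLineDatum) : Prop :=
  ∀ (Γ : Level V) (a : L) (Φ : CMType L) (θ : U.CohC (U.pms L ι₁ V Γ) 1), θ ∈ BD.lineTheta Γ a Φ → θ ≠ 0 →
    ∀ τ : L →+* ℂ, τ ≠ ι₁ → τ ≠ ComplexEmbedding.conjugate ι₁ → CD.orient τ = true →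
      (τ ∈ Φ.1 ↔ 0 < LD.wt Γ a Φ τ)

/-- **READING (labelled; compact places; never citable)**: for a block `(Γ, a, Φ)` carrying a non-zero class and a
Fock-holomorphic `τ` off `v₁`, the genuine weight `wt Γ a Φ τ` corresponds, in Adams' dictionary for
`(U(⟨a⟩_τ), U(V_τ)) = (U(1), U(3,0))` if `τ(a) > 0` resp. `(U(1), U(0,3))` if not, to the vacuum `K̃′`-type
`τ′_vac`.  CONTENT: global-to-local compatibility of the theta lift at the compact place (the compact-place instance of
`GlobalToLocal`; [Rallis84] p. 356 prints the localisation argument for O–Sp pairs) ∘ "a representation contributing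
to `H¹` of the ball quotient with trivial coefficients is trivial on the compact factor `U(V_τ) ≅ U(3)`, whose genuine
`K̃′`-type in Adams' normalisation is `τ′_vac = (1/2,1/2,1/2)`" ∘ the orientation of the pair by the sign of `a`. -/
def LocalAway (CD : BD.CompactLineDatum) : Prop :=
  ∀ (Γ : Level V) (a : L) (Φ : CMType L) (θ : U.CohC (U.pms L ι₁ V Γ) 1), θ ∈ BD.lineTheta Γ a Φ → θ ≠ 0 →
    ∀ τ : L →+* ℂ, τ ≠ ι₁ → τ ≠ ComplexEmbedding.conjugate ι₁ → CD.orient τ = true →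
      (0 < (τ a).re → (CD.Dpos Γ τ).corr (fun _ => LD.wt Γ a Φ τ) (vacuumTau 1 3 0)) ∧
      (¬ 0 < (τ a).re → (CD.Dneg Γ τ).corr (fun _ => LD.wt Γ a Φ τ) (vacuumTau 1 0 3))

variable (CD : BD.CompactLineDatum)

/-- KERNEL: Adams' Prop. 6.6 by name transfers to the re-weighted datum (same dictionaries). -/
theorem print_reweight (h : CD.Print) : (LD.reweight CD).Print := h

/-- KERNEL: the orientation seam transfers to the re-weighted datum (same orientation bits). -/
theorem frameOrientation_reweight {T : U.ThetaModel} (h : CD.FrameOrientation T) :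
    (LD.reweight CD).FrameOrientation T := h

/-- KERNEL: the compact reading on the character datum gives generation 8's `CompactTheta` for the re-weighted datum
(the weight is `wt Γ a Φ τ`, and it IS a weight of the block by the definition of `IsWt`). -/
theorem compactTheta_of_localAway (h : LD.LocalAway CD) : (LD.reweight CD).CompactTheta := by
  intro Γ a Φ θ hθ hne τ h₁ h₂ ho
  exact ⟨LD.wt Γ a Φ τ, ⟨h₁, h₂, ho, a, θ, hθ, hne, rfl⟩, h Γ a Φ θ hθ hne τ h₁ h₂ ho⟩

/-- KERNEL: the type definition gives generation 8's `TypeWeight` for the re-weighted datum. -/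
theorem typeWeight_of_typeDef (h : LD.TypeDef CD) : (LD.reweight CD).TypeWeight := by
  rintro Γ Φ τ σ ⟨h₁, h₂, ho, a, θ, hθ, hne, rfl⟩
  exact h Γ a Φ θ hθ hne τ h₁ h₂ ho

end LineLiftDatum

end BMMDict

/-! ## (C) The package BY NAME, generation 9, and the end states -/

/-- **The BMM–glue package, generation 9, faces** (`RealisationExistsFace` reduced): generation 8's `BMMPrintFace T`
with the `v₁` reading replaced by (`GlobalToLocalStable` — Li's stable-range theorem as printed in [Cossutta–Marshall
2013] — by name ∧ `LineDef` ∧ `LineDim` ∧ `SigConv`) and the compact readings re-based on the line-lift datum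
(`LocalAway`, `TypeDef`).  Conjunct classes: module docstring. -/
def BMMLiftFace (T : U.ThetaModel) : Prop :=
  ∀ (F : CMField), IsGalois ℚ F → 6 ≤ Module.finrank ℚ F →
    ∀ (f : Face F) (ι₁ : F →+* ℂ), f.Admissible ι₁ → ∀ V : HermSpace3 F ι₁,
      U.UisoDisjoint V ∧ U.UisoRigid V ∧ ∃ BD : U.BMMDict V, BD.Standard T ∧ (∀ Γ, (BD.X Γ).Cor79) ∧
        BD.LineAlbaneseLiu ∧ BD.ThetaOfLine T ∧ BD.LineOfTheta T ∧ BD.FrameBidegree T ∧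
        ∃ LD : BD.LineLiftDatum, LD.LineDef ∧ LD.LineDim ∧ LD.SigConv ∧
          (∃ AD : BD.ArchLineDatum,
            (∀ Γ, (AD.spectrum Γ).ArchSignature) ∧ (∀ Γ, (AD.spectrum Γ).GlobalToLocalStable)) ∧
          ∃ CD : BD.CompactLineDatum, CD.Print ∧ LD.LocalAway CD ∧ LD.TypeDef CD ∧ CD.FrameOrientation T

/-- **The BMM–glue package, generation 9, PerL binders** (`RealisationExistsPerL` reduced): as `BMMLiftFace`. -/
def BMMLiftPerL (T : U.ThetaModel) : Prop :=
  ∀ (K L : CMField) (j : K →+* L), IsNormalClosure ℚ K L →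
    Module.finrank ℚ K = 6 → (Module.finrank ℚ L = 24 ∨ Module.finrank ℚ L = 48) →
    ∀ (φ : Fin 3 → (K →+* ℂ)), IsFrame φ →
    ∀ (ι₁ : L →+* ℂ), ι₁.comp j = φ 0 →
    ∀ (t : Fin 4 → CMType K), IsPerLTypes φ t →
    ∀ V : HermSpace3 L ι₁,
      U.UisoDisjoint V ∧ U.UisoRigid V ∧ ∃ BD : U.BMMDict V, BD.Standard T ∧ (∀ Γ, (BD.X Γ).Cor79) ∧
        BD.LineAlbaneseLiu ∧ BD.ThetaOfLine T ∧ BD.LineOfTheta T ∧ BD.FrameBidegree T ∧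
        ∃ LD : BD.LineLiftDatum, LD.LineDef ∧ LD.LineDim ∧ LD.SigConv ∧
          (∃ AD : BD.ArchLineDatum,
            (∀ Γ, (AD.spectrum Γ).ArchSignature) ∧ (∀ Γ, (AD.spectrum Γ).GlobalToLocalStable)) ∧
          ∃ CD : BD.CompactLineDatum, CD.Print ∧ LD.LocalAway CD ∧ LD.TypeDef CD ∧ CD.FrameOrientation T

namespace ThetaModel

variable {T : U.ThetaModel}

/-- KERNEL: the generation-9 package implies generation 8's by-name package (faces): the `v₁` reading is derived
(`reading_of_globalToLocal`), the compact datum is re-weighted (`reweight`). -/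
theorem bmmPrintFace_of_lift (hX : U.BMMLiftFace T) : U.BMMPrintFace T := by
  intro F hG hdeg f ι₁ hadm V
  obtain ⟨hI, hR, BD, hBD, hB, hA, hTL, hLT, hF, LD, hD, h1, hS, ⟨AD, hP, hGL⟩, CD, hPr, hLoc, hTy, hFO⟩ :=
    hX F hG hdeg f ι₁ hadm V
  exact ⟨hI, hR, BD, hBD, hB, hA, hTL, hLT, hF, ⟨AD, hP, LD.reading_of_globalToLocalStable hBD AD hGL hD h1 hS⟩,
    LD.reweight CD, LD.print_reweight CD hPr, LD.compactTheta_of_localAway CD hLoc, LD.typeWeight_of_typeDef CD hTy,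
    LD.frameOrientation_reweight CD hFO⟩

/-- KERNEL: the generation-9 package implies generation 8's by-name package (PerL binders). -/
theorem bmmPrintPerL_of_lift (hX : U.BMMLiftPerL T) : U.BMMPrintPerL T := by
  intro K L j hN hK hL φ hφ ι₁ hι₁ t ht V
  obtain ⟨hI, hR, BD, hBD, hB, hA, hTL, hLT, hF, LD, hD, h1, hS, ⟨AD, hP, hGL⟩, CD, hPr, hLoc, hTy, hFO⟩ :=
    hX K L j hN hK hL φ hφ ι₁ hι₁ t ht V
  exact ⟨hI, hR, BD, hBD, hB, hA, hTL, hLT, hF, ⟨AD, hP, LD.reading_of_globalToLocalStable hBD AD hGL hD h1 hS⟩,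
    LD.reweight CD, LD.print_reweight CD hPr, LD.compactTheta_of_localAway CD hLoc, LD.typeWeight_of_typeDef CD hTy,
    LD.frameOrientation_reweight CD hFO⟩

end ThetaModel

variable (U)

/-- **COR-CM — the lineage's end state, generation 9**: `HC_CM` from the DAG's binders, the generation-9 package
`BMMLiftFace T` (`RealisationExistsFace` reduced; census in the module docstring), `PohlmannSpan`, `Qw8Sufficiency`. -/
theorem COR_CM_of_liu_bmmLift (M : U.ModelAxioms) (h38 : U.Fact_cmInflation) (hV : U.Fact_virtualCup11₂)
    (hL : U.LiuSupplyFace) {T : U.ThetaModel} (h₂ : T.Fact_innerEmb) (h₅ : T.Open_thetaSub)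
    (h₇ : T.Open_thetaGen12) (h₈ : T.Open_thetaReal34) (h₉ : T.Open_chars) (h₁₀ : T.Open_occ)
    (hHR : U.Fact_hodgeRiemann20) (hk : T.kappa = SignRecipe.kappa false) (hs : T.Design_frameSignConj)
    {Hk : U.HeckeData} (hD : U.IsoEmbFace Hk T) (hX : U.BMMLiftFace T)
    (hPo : U.PohlmannSpan) (hQ : U.Qw8Sufficiency) : U.HC_CM :=
  U.COR_CM_of_liu_bmmPrint M h38 hV hL h₂ h₅ h₇ h₈ h₉ h₁₀ hHR hk hs hD (ThetaModel.bmmPrintFace_of_lift hX) hPo hQ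

/-- **PerL v5 Thm 4.4 — end state, generation 9.** -/
theorem perL44_of_liu_bmmLift (M : U.ModelAxioms) (h38 : U.Fact_cmInflation) (hV : U.Fact_virtualCup11₂)
    (hL : U.LiuSupplyPerL) {T : U.ThetaModel} (h₂ : T.Fact_innerEmb) (h₅ : T.Open_thetaSub)
    (h₇ : T.Open_thetaGen12) (h₈ : T.Open_thetaReal34) (h₉ : T.Open_chars) (h₁₀ : T.Open_occ)
    (hHR : U.Fact_hodgeRiemann20) (hk : T.kappa = SignRecipe.kappa false) (hs : T.Design_frameSignConj)
    {Hk : U.HeckeData} (hD : U.IsoEmbPerL Hk T) (hX : U.BMMLiftPerL T) : U.PerL44 :=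
  U.perL44_of_liu_bmmPrint M h38 hV hL h₂ h₅ h₇ h₈ h₉ h₁₀ hHR hk hs hD (ThetaModel.bmmPrintPerL_of_lift hX)

/-- **PerL (`W_per^L`) — end state, generation 9** (`RealisationExistsPerL` reduced; census in the module docstring). -/
theorem perL_of_liu_bmmLift (M : U.ModelAxioms) (h38 : U.Fact_cmInflation) (hV : U.Fact_virtualCup11₂)
    (hL : U.LiuSupplyPerL) {T : U.ThetaModel} (h₂ : T.Fact_innerEmb) (h₅ : T.Open_thetaSub)
    (h₇ : T.Open_thetaGen12) (h₈ : T.Open_thetaReal34) (h₉ : T.Open_chars) (h₁₀ : T.Open_occ)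
    (hHR : U.Fact_hodgeRiemann20) (hk : T.kappa = SignRecipe.kappa false) (hs : T.Design_frameSignConj)
    {Hk : U.HeckeData} (hD : U.IsoEmbPerL Hk T) (hX : U.BMMLiftPerL T) : U.PerL :=
  U.perL_of_liu_bmmPrint M h38 hV hL h₂ h₅ h₇ h₈ h₉ h₁₀ hHR hk hs hD (ThetaModel.bmmPrintPerL_of_lift hX)

/-! ### Junction with strategy 1 (prl1): the constructed theta model at the frame bit `h = false` -/

/-- **COR-CM over strategy 1's constructed theta model, generation-9 route** (design pins are theorems:
`AdelicThetaCore₀.thetaModel_kappa`, `.design_frameSignConj`). -/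
theorem COR_CM_of_liu_bmmLift_adelic (M : U.ModelAxioms) (h38 : U.Fact_cmInflation)
    (hV : U.Fact_virtualCup11₂) (hL : U.LiuSupplyFace)
    (C : U.AdelicThetaCore₀) (d12 d34 : ∀ {L : CMField}, SeesawCtx L → SideData L)
    (h₂ : (C.thetaModel false d12 d34).Fact_innerEmb) (h₅ : (C.thetaModel false d12 d34).Open_thetaSub)
    (h₇ : (C.thetaModel false d12 d34).Open_thetaGen12) (h₈ : (C.thetaModel false d12 d34).Open_thetaReal34)
    (h₉ : (C.thetaModel false d12 d34).Open_chars) (h₁₀ : (C.thetaModel false d12 d34).Open_occ)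
    (hHR : U.Fact_hodgeRiemann20) {Hk : U.HeckeData} (hD : U.IsoEmbFace Hk (C.thetaModel false d12 d34))
    (hX : U.BMMLiftFace (C.thetaModel false d12 d34)) (hPo : U.PohlmannSpan) (hQ : U.Qw8Sufficiency) :
    U.HC_CM :=
  U.COR_CM_of_liu_bmmPrint_adelic M h38 hV hL C d12 d34 h₂ h₅ h₇ h₈ h₉ h₁₀ hHR hD
    (ThetaModel.bmmPrintFace_of_lift hX) hPo hQ

/-- **PerL over strategy 1's constructed theta model, generation-9 route** — the lineage's sharpest typed reduction of
`RealisationExistsPerL`: binder census in the module docstring; THE input not in print is `LineDef`. -/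
theorem perL_of_liu_bmmLift_adelic (M : U.ModelAxioms) (h38 : U.Fact_cmInflation)
    (hV : U.Fact_virtualCup11₂) (hL : U.LiuSupplyPerL)
    (C : U.AdelicThetaCore₀) (d12 d34 : ∀ {L : CMField}, SeesawCtx L → SideData L)
    (h₂ : (C.thetaModel false d12 d34).Fact_innerEmb) (h₅ : (C.thetaModel false d12 d34).Open_thetaSub)
    (h₇ : (C.thetaModel false d12 d34).Open_thetaGen12) (h₈ : (C.thetaModel false d12 d34).Open_thetaReal34)
    (h₉ : (C.thetaModel false d12 d34).Open_chars) (h₁₀ : (C.thetaModel false d12 d34).Open_occ)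
    (hHR : U.Fact_hodgeRiemann20) {Hk : U.HeckeData} (hD : U.IsoEmbPerL Hk (C.thetaModel false d12 d34))
    (hX : U.BMMLiftPerL (C.thetaModel false d12 d34)) : U.PerL :=
  U.perL_of_liu_bmmPrint_adelic M h38 hV hL C d12 d34 h₂ h₅ h₇ h₈ h₉ h₁₀ hHR hD
    (ThetaModel.bmmPrintPerL_of_lift hX)

end Universe

end HodgeCM

end
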